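import Mathlib
import HarnessLib

/-!
# Stub B1c″ `stub_integrableOn_cosTransform_of_secondDifference` of line `kinetic-polymer-gas-on-the-time-axis`
(crux `EmbeddedDrudeMourre.DrudeDissolution`, item stmt-AtomisticToContinuum-12593; `--supports` file, closes
nothing; lead c13, 2026-08-17)

WHAT. Generic real analysis (Mathlib only): if a finite measure `m` on `ℝ` has a second-order modulus of
smoothness of order `1 + α`, `α > 0`, in the dual (test-function) form
`|∫ (2φ(x) − φ(x+δ) − φ(x−δ)) dm(x)| ≤ C δ^{1+α}` for every `δ > 0` and every `C²` test function `φ` with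
`|φ| ≤ 1`, then the cosine transform `F(t) = ∫ cos(t x) dm(x)` is integrable on `(0, ∞)`.

HOW. `F` is continuous (dominated convergence with the constant bound `1`, integrable since `m` is finite),
hence integrable on `(0, 1]`. For `t > 0` test the hypothesis with `φ = cos(t·)` and `δ = π/t`:
`cos(t(x ± π/t)) = −cos(tx)`, so the second difference integrates to `4F(t)` and
`|F(t)| ≤ (C/4)(π/t)^{1+α} = (C/4)π^{1+α} · t^{−(1+α)}`, which is integrable on `(1, ∞)` because
`−(1+α) < −1` (`integrableOn_Ioi_rpow_of_lt`). Glue `(0, ∞) = (0, 1] ∪ (1, ∞)`.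
-/

noncomputable section

open MeasureTheory Filter Set Real Topology

namespace Summit.AtomisticToContinuum.FouriersLaw.Theorems.DrudeDissolution.KineticPolymerGasOnTheTimeAxis

/-- The cosine transform `t ↦ ∫ cos(t x) dm(x)` of a finite measure `m` on `ℝ` is continuous
(dominated convergence with the bound `|cos| ≤ 1`, integrable because `m` is finite). [folklore] -/
theorem continuous_cosTransform_of_isFiniteMeasure (m : Measure ℝ) [IsFiniteMeasure m] :
    Continuous fun t : ℝ => ∫ x, Real.cos (t * x) ∂m := by
  refine continuous_of_dominated (bound := fun _ => (1 : ℝ)) ?_ ?_ (integrable_const 1) ?_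
  · intro t
    exact (Real.continuous_cos.comp (continuous_const.mul continuous_id)).aestronglyMeasurable
  · intro t
    exact Eventually.of_forall fun x => by
      simpa only [Real.norm_eq_abs] using Real.abs_cos_le_one (t * x)
  · exact Eventually.of_forall fun x =>
      Real.continuous_cos.comp (continuous_id.mul continuous_const)

/-- Pointwise decay extracted from the dual second-order modulus of smoothness: testing the hypothesis
with `φ = cos(t·)` and `δ = π/t` (so that `cos(t(x ± δ)) = −cos(tx)` and the second difference is
`4 cos(tx)`) gives `|∫ cos(t x) dm(x)| ≤ (C/4)·π^{1+α}·t^{−(1+α)}` for every `t > 0`. [folklore] -/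
theorem abs_cosTransform_le_of_secondDifference (m : Measure ℝ) (C α : ℝ)
    (hmod : ∀ δ : ℝ, 0 < δ → ∀ φ : ℝ → ℝ, ContDiff ℝ 2 φ → (∀ x, |φ x| ≤ 1) →
      |∫ x, (2 * φ x - φ (x + δ) - φ (x - δ)) ∂m| ≤ C * δ ^ (1 + α))
    {t : ℝ} (ht : 0 < t) :
    |∫ x, Real.cos (t * x) ∂m| ≤ C / 4 * π ^ (1 + α) * t ^ (-(1 + α)) := by
  have hδ : 0 < π / t := div_pos Real.pi_pos ht
  have hφ : ContDiff ℝ 2 fun x : ℝ => Real.cos (t * x) := by fun_prop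
  have hφ1 : ∀ x : ℝ, |Real.cos (t * x)| ≤ 1 := fun x => Real.abs_cos_le_one _
  -- the second difference of `cos(t·)` at step `π/t` is `4 cos(t·)`
  have hpt : ∀ x : ℝ,
      2 * Real.cos (t * x) - Real.cos (t * (x + π / t)) - Real.cos (t * (x - π / t)) =
        4 * Real.cos (t * x) := by
    intro x
    have h1 : t * (x + π / t) = t * x + π := by rw [mul_add, mul_div_cancel₀ _ ht.ne']
    have h2 : t * (x - π / t) = t * x - π := by rw [mul_sub, mul_div_cancel₀ _ ht.ne']
    rw [h1, h2, Real.cos_add_pi, Real.cos_sub_pi]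
    ring
  have hint :
      ∫ x, (2 * Real.cos (t * x) - Real.cos (t * (x + π / t)) - Real.cos (t * (x - π / t))) ∂m =
        4 * ∫ x, Real.cos (t * x) ∂m := by
    rw [← integral_const_mul]
    exact integral_congr_ae (Eventually.of_forall hpt)
  -- instantiate the hypothesis (the test function is fed explicitly; the statement is up to `β`)
  have key :
      |∫ x, (2 * Real.cos (t * x) - Real.cos (t * (x + π / t)) - Real.cos (t * (x - π / t))) ∂m| ≤
        C * (π / t) ^ (1 + α) :=
    hmod (π / t) hδ (fun x => Real.cos (t * x)) hφ hφ1
  rw [hint, abs_mul, abs_of_pos (by norm_num : (0 : ℝ) < 4),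
    Real.div_rpow Real.pi_pos.le ht.le] at key
  -- `key : 4 * |F t| ≤ C * (π ^ (1 + α) / t ^ (1 + α))`
  rw [Real.rpow_neg ht.le]
  have hrw : C / 4 * π ^ (1 + α) * (t ^ (1 + α))⁻¹ = C * (π ^ (1 + α) / t ^ (1 + α)) / 4 := by
    ring
  rw [hrw, le_div_iff₀ (by norm_num : (0 : ℝ) < 4)]
  linarith [key]

/-- **Stub B1c″ `stub_integrableOn_cosTransform_of_secondDifference` (registered signature, verbatim).**
If a finite measure `m` on `ℝ` has a second-order modulus of order `1 + α` (`α > 0`) in the dual form —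
`|∫ (2φ(x) − φ(x+δ) − φ(x−δ)) dm| ≤ C δ^{1+α}` for all `δ > 0` and all `C²` test functions `|φ| ≤ 1` — then
its cosine transform `F(t) = ∫ cos(t x) dm(x)` is integrable on `(0, ∞)`: `F` is continuous, hence
integrable on `(0, 1]`; on `(1, ∞)` it is dominated by `(C/4)π^{1+α} t^{−(1+α)}`
(`abs_cosTransform_le_of_secondDifference`), integrable since `−(1+α) < −1`. [folklore] -/
theorem stub_integrableOn_cosTransform_of_secondDifference :
    ∀ (m : MeasureTheory.Measure ℝ) [MeasureTheory.IsFiniteMeasure m] (C α : ℝ), 0 < α →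
      (∀ δ : ℝ, 0 < δ → ∀ φ : ℝ → ℝ, ContDiff ℝ 2 φ → (∀ x, |φ x| ≤ 1) →
        |∫ x, (2 * φ x - φ (x + δ) - φ (x - δ)) ∂m| ≤ C * δ ^ (1 + α)) →
      MeasureTheory.IntegrableOn (fun t : ℝ => ∫ x, Real.cos (t * x) ∂m) (Set.Ioi 0) := by
  intro m _ C α hα hmod
  have hcont := continuous_cosTransform_of_isFiniteMeasure m
  -- near `0`: a continuous function is integrable on the compact `[0, 1] ⊇ (0, 1]`
  have h01 : IntegrableOn (fun t : ℝ => ∫ x, Real.cos (t * x) ∂m) (Ioc 0 1) :=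
    (hcont.continuousOn.integrableOn_compact isCompact_Icc).mono_set Ioc_subset_Icc_self
  -- at infinity: domination by `(C/4)π^{1+α} · t^{−(1+α)}`, exponent `−(1+α) < −1`
  have h1 : IntegrableOn (fun t : ℝ => ∫ x, Real.cos (t * x) ∂m) (Ioi 1) := by
    have hg : IntegrableOn (fun t : ℝ => C / 4 * π ^ (1 + α) * t ^ (-(1 + α))) (Ioi 1) :=
      (integrableOn_Ioi_rpow_of_lt (by linarith) one_pos).const_mul (C / 4 * π ^ (1 + α))
    refine Integrable.mono' hg hcont.aestronglyMeasurable ?_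
    refine (ae_restrict_iff' measurableSet_Ioi).2 (Eventually.of_forall fun t ht => ?_)
    rw [Real.norm_eq_abs]
    exact abs_cosTransform_le_of_secondDifference m C α hmod (lt_trans one_pos ht)
  rw [← Ioc_union_Ioi_eq_Ioi zero_le_one]
  exact h01.union h1

end Summit.AtomisticToContinuum.FouriersLaw.Theorems.DrudeDissolution.KineticPolymerGasOnTheTimeAxis

end
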